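import Literature.MathematicalPhysics.QuantumFieldTheory.Balaban1983to89.B7Eq162GeneralRec
import Literature.MathematicalPhysics.QuantumFieldTheory.Balaban1983to89.B7Eq108ConcreteRec
import Literature.MathematicalPhysics.QuantumFieldTheory.Balaban1983to89.B7Eq167Flat

/-!
# `Balaban1983to89.B7Eq167GeneralRec` — [Balaban1985Averaging] Sect. F p. 43: the gauge fixing (104)–(106) lies in the class `Λ_k(U₀, α₃)` (166)–(167) AT A GENERAL REGULAR BACKGROUND, FOR THE
# RECORD's AVERAGING STRUCTURE ([Balaban1987RG1] (0.4)) — the record twin of the engine's `B7Eq167General`, with `α₃ = 20dKZ·L^kb`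

statement-level skeleton of published theorems with citation tags; proofs where landed; nothing here is a claim about the Yang–Mills mass gap

CITATION HEADER (lean-in-tree rule).  Cell `pub-ymgap`, seat `pub-ymgap-dag-n05-e` g36 (N05-REC LEAD PEN); item R1 ([3] layer): the record twin of `B7Eq167General` (lit-balaban p29 gen 6).
`--kind proof --supports stmt-QuantumFields-20541` (K0⁷; count-neutral; no definition).  Sources READ: [3] = [Balaban1985Averaging] p. 43 (165) and the paragraph after it, p. 44 (166)–(167), p. 33
(104)–(108), p. 42 (161) (`paper:balaban1985-cmp98-averaging`); [I] = [Balaban1987RG1] (0.4) p. 253.  REUSED BY NAME: `B7SectEFLinearisationRec.Cond166Z ∕ Cond167Z ∕ InLambdaZ` (landed record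
defs), `B7Eq108ConcreteRec.eq107Z ∕ eq108Z` + `B7Eq106ConcreteRec.telUpZ_succ` + `B7Eq84ConcreteRec.axialGaugeZ_glevZ ∕ eq81_glevZ` (g35 drafts R1f–R1h), `B7Eq162GeneralRec.level_factsZ` (g36), the
engine's arithmetic `B7Eq167Flat.norm_dprod_sub_one_le ∕ norm_mul_sub_one_le_exp ∕ exp_sub_one_le_two_mul_of_le ∕ sum_pow_succ_le`, `B7Prop3GeneralAnalytic.norm_tHol_expCfg_sub_one_le`,
`B7Prop3GeneralAnalyticRec.norm_FcovZ_le_of_tHol`.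

WHAT IS PROVED (sorry-free; `b` plays `ηα₁`; the record's (161) constant `KZ = 2(1+4dL)` replaces print's `2`: `θ_m = dKZ·L^{m+1}b`).  §1 `telUpZ_mem_U1`.  §2 (generic one-level bounds at a unit-bounded
background on the record's single-staircase tree contours `treeWord (offZ L r)`): `norm_tHol_treeWordZ_sub_one_le` (`≤ e^{dL·a} − 1`), `one_add_norm_wframeZ_inv_sub_one_le` (`≤ e^{4θ}`),
`norm_conj_frameZInv_mul_transport_sub_one_le` (`≤ e^{5θ} − 1`).  §3 the tower under the data of `B7Eq123GeneralRec.prop4_generalZ` + `64·d·KZ·L^kb ≤ 1`: `norm_levelFactorZ_general`, ★`cond166Z_general`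
((166) with `α₃ = e^{10dKZ·L^kb} − 1`), ★`cond167Z_general` ((167) with right-hand side `e^{θ_j} − 1`), ★★`inLambdaZ_general` — EVERY solution `u` of (67) + (81) for the record lies in `Λ_k(U₀, 20dKZ·L^kb)`
(`η = L^{−k}`), `inLambdaZ_glevZ_general` (the constructed gauge fixing `glevZ`), `norm_sub_one_le_of_gaugeFixingZ` ∕ `norm_glevZ_sub_one_le` ((166) at `j = 0`: `|u(x) − 1| ≤ 20dKZ·L^kb`).
HONEST SCOPE.  Port of the engine's certificate to the record's objects with the record's Prop-4 constant; nothing of [3]∕[I] asserted beyond what is proved; `HThm4Rec` UNDISCHARGED; N05 discharged of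
record untouched; N07 not claimable; counts unmoved (typed 28∕28 · discharged 8∕28); one finite 𝕋⁴ programme at fixed ε — nothing continuum ∕ ℝ⁴ ∕ OS ∕ mass gap ∕ Clay.  No `def`, no `instance`,
no `notation`, no `sorry`.
-/

set_option autoImplicit false

noncomputable section

open scoped BigOperators
open NormedSpace Finset

namespace Literature.MathematicalPhysics.QuantumFieldTheory.Balaban1983to89.B7Eq167GeneralRec

open B7Prop1Explicit hiding Site
open B7Prop1Explicit renaming Site → SiteZ
open B7Prop2Explicit (pdev c2')
open B7Prop3Flat (expCfg c3)
open B7Eq92Concrete (tHol Rc Rc_apply)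
open B7Eq106Concrete (dprod)
open MatrixLog
open BlockAveragingZd (avgIterZ offZ)
open B7SectCDGaugeAveragesRec (FcovZ wframeZ dbavgCovIterZ uavgZ uavgZ_zero AxialGaugeZ glevZ flZ lvHolZ lvFrZ lvDbTZ telUpZ)
open B7SectEFLinearisationRec (logCovIterZ Cond166Z Cond167Z InLambdaZ)
open B7Prop2Rec (AvgClosedZ C0Z)
open B7Prop3FlatRecSide (l1_offZ_le_dL)
open B7Prop3GeneralAnalytic (norm_tHol_expCfg_sub_one_le)
open B7Prop3GeneralAnalyticRec (norm_FcovZ_le_of_tHol)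
open B7Prop4GeneralLevelsRec (cZ KZ gZ_nonneg)
open B7Eq84ConcreteRec (axialGaugeZ_glevZ eq81_glevZ)
open B7Eq106ConcreteRec (telUpZ_zero telUpZ_succ)
open B7Eq108ConcreteRec (eq107Z eq108Z)
open B7Eq162GeneralRec (level_factsZ)
open B7Eq167Flat (norm_dprod_sub_one_le norm_mul_sub_one_le_exp exp_sub_one_le_two_mul_of_le sum_pow_succ_le)

variable {d : ℕ}
variable {𝔸 : Type*} [NormedRing 𝔸] [NormedAlgebra ℂ 𝔸] [CompleteSpace 𝔸] [NormOneClass 𝔸]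

/-! ## §1 The telescoped background transporters are unit-bounded -/

/-- `Ū₀^i(Γ^{(n)}_{x_{i+n},x_i}) ∈ U1` for the record as soon as the averaged backgrounds `Ū₀^m`, `m < i + n`, are unit-bounded. [cite: Balaban1985Averaging, p.29 (display before (77)), (107) p.33] -/
theorem telUpZ_mem_U1 {L : ℕ} (hL : 1 ≤ L) {U₀ : SiteZ d → Fin d → 𝔸ˣ} (i : ℕ) :
    ∀ n : ℕ, (∀ m < i + n, ∀ x κ, avgIterZ L U₀ m x κ ∈ U1 𝔸) → ∀ x : SiteZ d, telUpZ L hL U₀ i n x ∈ U1 𝔸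
  | 0, _, x => by rw [telUpZ_zero]; exact (U1 𝔸).one_mem
  | n + 1, h, x => by
    rw [telUpZ_succ, lvHolZ]
    exact (U1 𝔸).mul_mem (hol_mem (h (i + n) (by omega)) _ _) (telUpZ_mem_U1 hL i n (fun m hm => h m (by omega)) x)

/-! ## §2 Generic one-level bounds at a unit-bounded background, record tree contours -/

/-- **Transport bound (record contour).**  At a unit-bounded background `V₀`, for `V₁ = e^{A}` with `|A| ≤ a`: the twisted transport (58) along the record's single-staircase tree contour `Γ_{y,x}`,
`x = y + offZ L r` (length `≤ dL`), is within `e^{dL·a} − 1` of `1`. [cite: Balaban1985Averaging, (58) p.27, (108) p.33, (161) p.42; Balaban1987RG1, (0.4) p.253] -/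
theorem norm_tHol_treeWordZ_sub_one_le {L : ℕ} {V₀ : SiteZ d → Fin d → 𝔸ˣ} (hV₀ : ∀ x κ, V₀ x κ ∈ U1 𝔸)
    (A : SiteZ d → Fin d → 𝔸) {a : ℝ} (ha : 0 ≤ a) (hA : ∀ x κ, ‖A x κ‖ ≤ a) (y : SiteZ d) (r : Fin d → Fin L) :
    ‖((tHol V₀ (expCfg A) y (treeWord (offZ L r)) : 𝔸ˣ) : 𝔸) - 1‖ ≤ Real.exp (((d * L : ℕ) : ℝ) * a) - 1 := by
  refine (norm_tHol_expCfg_sub_one_le hV₀ A hA _ y).trans (sub_le_sub_right (Real.exp_le_exp.mpr ?_) 1)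
  have hlen : (((treeWord (offZ L r)).length : ℕ) : ℝ) ≤ ((d * L : ℕ) : ℝ) := by
    exact_mod_cast (show (treeWord (offZ L r)).length ≤ d * L by rw [length_treeWord]; exact l1_offZ_le_dL L r)
  exact mul_le_mul_of_nonneg_right hlen ha

/-- **Frame bound (record frame).**  At a unit-bounded background, `V₁ = e^{A}`, `|A| ≤ a`, `dL·a ≤ θ ≤ 1/64`: the INVERSE record block frame `(\overline{R_{0,y}V₁})⁻¹ = exp(−F(y))` satisfies
`1 + |(\overline{R_{0,y}V₁})⁻¹ − 1| ≤ e^{4θ}`. [cite: Balaban1985Averaging, (110)–(112) p.34, (82) p.30; Balaban1987RG1, (0.4) p.253] -/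
theorem one_add_norm_wframeZ_inv_sub_one_le {L : ℕ} (hL : 1 ≤ L) {V₀ : SiteZ d → Fin d → 𝔸ˣ} (hV₀ : ∀ x κ, V₀ x κ ∈ U1 𝔸)
    (A : SiteZ d → Fin d → 𝔸) {a θ : ℝ} (ha : 0 ≤ a) (hA : ∀ x κ, ‖A x κ‖ ≤ a) (hθ : ((d * L : ℕ) : ℝ) * a ≤ θ)
    (hθ0 : 0 ≤ θ) (hθ1 : θ ≤ 1 / 64) (y : SiteZ d) :
    1 + ‖((((wframeZ L V₀ (expCfg A) y)⁻¹ : 𝔸ˣ) : 𝔸)) - 1‖ ≤ Real.exp (4 * θ) := by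
  have hτ : ∀ r : Fin d → Fin L, ‖((tHol V₀ (expCfg A) y (treeWord (offZ L r)) : 𝔸ˣ) : 𝔸) - 1‖ ≤ 2 * θ :=
    fun r => (norm_tHol_treeWordZ_sub_one_le hV₀ A ha hA y r).trans (exp_sub_one_le_of_le hθ hθ0 hθ1)
  have hF : ‖FcovZ L V₀ (expCfg A) y‖ ≤ 2 * (2 * θ) := norm_FcovZ_le_of_tHol hL V₀ (expCfg A) y hτ (by linarith)
  have hF' : ‖-FcovZ L V₀ (expCfg A) y‖ ≤ 4 * θ := by rw [norm_neg]; linarith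
  rw [wframeZ, val_inv_expUnit, val_expUnit]
  linarith [(norm_exp_sub_one_le_of_norm_le hF').1]

/-- **A level factor of (106)/(107), record.**  At a unit-bounded background, field `e^{A}`, `|A| ≤ a`, `dL·a ≤ θ ≤ 1/64`, and a unit-bounded `T`:
`|R(T)⁻¹[(\overline{R_{0,y}V₁})⁻¹(R_{0,y}V₁)(Γ_{y,x})] − 1| ≤ e^{5θ} − 1`. [cite: Balaban1985Averaging, (106)–(107) p.33, (56)–(57) p.27] -/
theorem norm_conj_frameZInv_mul_transport_sub_one_le {L : ℕ} (hL : 1 ≤ L) {V₀ : SiteZ d → Fin d → 𝔸ˣ}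
    (hV₀ : ∀ x κ, V₀ x κ ∈ U1 𝔸) (A : SiteZ d → Fin d → 𝔸) {a θ : ℝ} (ha : 0 ≤ a) (hA : ∀ x κ, ‖A x κ‖ ≤ a)
    (hθ : ((d * L : ℕ) : ℝ) * a ≤ θ) (hθ0 : 0 ≤ θ) (hθ1 : θ ≤ 1 / 64) {T : 𝔸ˣ} (hT : T ∈ U1 𝔸) (y : SiteZ d)
    (r : Fin d → Fin L) :
    ‖((Rc T⁻¹ ((wframeZ L V₀ (expCfg A) y)⁻¹ * tHol V₀ (expCfg A) y (treeWord (offZ L r))) : 𝔸ˣ) : 𝔸) - 1‖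
      ≤ Real.exp (5 * θ) - 1 := by
  simp only [Rc_apply, inv_inv, Units.val_mul]
  refine (norm_units_inv_conj_sub_one_le hT _).trans ?_
  have ht : 1 + ‖((tHol V₀ (expCfg A) y (treeWord (offZ L r)) : 𝔸ˣ) : 𝔸) - 1‖ ≤ Real.exp θ := by
    have h := norm_tHol_treeWordZ_sub_one_le hV₀ A ha hA y r
    linarith [Real.exp_le_exp.mpr hθ]
  rw [show 5 * θ = 4 * θ + θ by ring]
  exact norm_mul_sub_one_le_exp (one_add_norm_wframeZ_inv_sub_one_le hL hV₀ A ha hA hθ hθ0 hθ1 y) ht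

/-! ## §3 The tower at a general regular background, for the record -/

section Tower

variable {L : ℕ} {s : ℕ} {G : Subgroup 𝔸ˣ} {k : ℕ} {U₀ : SiteZ d → Fin d → 𝔸ˣ} {α₀ : ℝ} {B : SiteZ d → Fin d → 𝔸} {b : ℝ}

/-- the record's level parameter `θ_m = dL·(KZ·L^mb) = dKZ·L^{m+1}b`. [cite: Balaban1985Averaging, (161) p.42] -/
private theorem thetaZ_eq (m : ℕ) : ((d * L : ℕ) : ℝ) * (KZ d L * ((L : ℝ) ^ m * b)) = (d : ℝ) * KZ d L * b * (L : ℝ) ^ (m + 1) := by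
  push_cast; ring

/-- `θ_m ≤ 1∕64` for `m < k` under `64·d·KZ·L^kb ≤ 1` (`L ≥ 1`, `b ≥ 0`). [cite: Balaban1985Averaging, (161)–(162) p.42] -/
private theorem thetaZ_le (hL1 : 1 ≤ L) (hb : 0 ≤ b) (hs : 64 * (d : ℝ) * KZ d L * ((L : ℝ) ^ k * b) ≤ 1) {m : ℕ} (hm : m < k) :
    0 ≤ (d : ℝ) * KZ d L * b * (L : ℝ) ^ (m + 1) ∧ (d : ℝ) * KZ d L * b * (L : ℝ) ^ (m + 1) ≤ 1 / 64 := by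
  have hK : 0 ≤ KZ d L := by unfold KZ; have := gZ_nonneg d L; positivity
  have hL' : (1 : ℝ) ≤ L := by exact_mod_cast hL1
  have hpow : (L : ℝ) ^ (m + 1) ≤ (L : ℝ) ^ k := pow_le_pow_right₀ hL' hm
  have h0 : 0 ≤ (d : ℝ) * KZ d L * b := by positivity
  refine ⟨by positivity, ?_⟩
  have := mul_le_mul_of_nonneg_left hpow h0
  nlinarith

/-- **The level-`m` factor of (107) at a general regular background, record** (`m = j + i < k`): within `e^{5θ_m} − 1` of `1`, `θ_m = dKZ·L^{m+1}b` — §2 at the background `Ū₀^m` with the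
field `U̿^m = e^{Q_m}`, `|Q_m| ≤ KZ·L^mb` ((161)_rec, `level_factsZ`), and `T = Ū₀^j(Γ^{(i+1)}_{x_{j+i+1},x_j})` unit-bounded (§1). [cite: Balaban1985Averaging, (107) p.33, (161) p.42] -/
theorem norm_levelFactorZ_general (hLs : L = 2 * s + 1) (hs1 : 1 ≤ s) (hd : 1 ≤ d) (hG : AvgClosedZ d L G) (hU₀ : ∀ x κ, U₀ x κ ∈ G) (hα : 0 < α₀)
    (hα3 : C0Z d * α₀ ≤ 1 / 3) (hα4 : 4 * α₀ ≤ c2' d L) (h52 : pdev U₀ < α₀ * (((L : ℝ) ^ k)⁻¹) ^ 2)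
    (hb : 0 ≤ b) (hB : ∀ x κ, ‖B x κ‖ ≤ b)
    (hsmall : Real.exp (4 * cZ d * α₀) * (1 + 2 * (131072 * ((d : ℝ) + 1) ^ 2) * (KZ d L) ^ 2 * ((L : ℝ) ^ k * b)) ≤ 2)
    (hc₃ : KZ d L * ((L : ℝ) ^ k * b) ≤ c3 d L) (hs : 64 * (d : ℝ) * KZ d L * ((L : ℝ) ^ k * b) ≤ 1)
    (hL1 : 1 ≤ L) {j i : ℕ} (hji : j + i < k) (x : SiteZ d) :
    ‖((Rc (telUpZ L hL1 U₀ j (i + 1) x)⁻¹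
        ((lvFrZ L U₀ (expCfg B) (j + i) x)⁻¹ * lvDbTZ L hL1 U₀ (expCfg B) (j + i) x) : 𝔸ˣ) : 𝔸) - 1‖
      ≤ Real.exp (5 * ((d : ℝ) * KZ d L * b * (L : ℝ) ^ (j + i + 1))) - 1 := by
  obtain ⟨hV, hW, hQ⟩ := level_factsZ hLs hs1 hd hG hU₀ hα hα3 hα4 h52 hb hB hsmall hc₃ (j + i) hji.le
  have hT : telUpZ L hL1 U₀ j (i + 1) x ∈ U1 𝔸 :=
    telUpZ_mem_U1 hL1 j (i + 1) (fun m hm => (level_factsZ hLs hs1 hd hG hU₀ hα hα3 hα4 h52 hb hB hsmall hc₃ m (by omega)).1) x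
  have hK : 0 ≤ KZ d L := by unfold KZ; have := gZ_nonneg d L; positivity
  have ha : (0 : ℝ) ≤ KZ d L * ((L : ℝ) ^ (j + i) * b) := by positivity
  obtain ⟨hθ0, hθ1⟩ := thetaZ_le (d := d) hL1 hb hs hji
  simp only [lvFrZ, lvDbTZ, hW]
  exact norm_conj_frameZInv_mul_transport_sub_one_le hL1 hV _ ha hQ (le_of_eq (thetaZ_eq (j + i))) hθ0 hθ1 hT _ _

omit [NormedAlgebra ℂ 𝔸] [CompleteSpace 𝔸] [NormOneClass 𝔸] in
/-- `(flZ L)^[j] (L^j·z) = z`: the level-`j` site `z` is reached from the site `L^jz` of the fine lattice (centred floor; the nesting of (43)∕(0.3)). [cite: Balaban1985Averaging, (43) p.24; Balaban1987RG1, (0.3) p.252 (bookkeeping)] -/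
theorem iterate_flZ_pow_smul (hL1 : 1 ≤ L) : ∀ (j : ℕ) (z : SiteZ d), (flZ L)^[j] (((L : ℤ) ^ j) • z) = z
  | 0, z => by simp
  | j + 1, z => by
    rw [Function.iterate_succ_apply, pow_succ, mul_comm, ← smul_smul, B7SectCDGaugeAveragesRec.flZ_smul hL1,
      iterate_flZ_pow_smul hL1 j z]

/-- ★ **(166) AT A GENERAL REGULAR BACKGROUND, FOR THE RECORD** — every solution `u` of (67) + (81) relative to `U₀`, `U₁ = e^{B}`, `|B| ≤ b` satisfies `|(\overline{R₀u}^j)(x_j) − 1| ≤ e^{10dKZ·L^kb} − 1`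
for all `j ≤ k` and all level-`j` sites — by (107) for the record (`eq107Z`), the level factor bounds and `Σ_{m=j}^{k−1} 5θ_m ≤ 10dKZ·L^kb`. [cite: Balaban1985Averaging, (166) p.44, (107) p.33, (161) p.42] -/
theorem cond166Z_general (hLs : L = 2 * s + 1) (hs1 : 1 ≤ s) (hd : 1 ≤ d) (hG : AvgClosedZ d L G) (hU₀ : ∀ x κ, U₀ x κ ∈ G) (hα : 0 < α₀)
    (hα3 : C0Z d * α₀ ≤ 1 / 3) (hα4 : 4 * α₀ ≤ c2' d L) (h52 : pdev U₀ < α₀ * (((L : ℝ) ^ k)⁻¹) ^ 2)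
    (hb : 0 ≤ b) (hB : ∀ x κ, ‖B x κ‖ ≤ b)
    (hsmall : Real.exp (4 * cZ d * α₀) * (1 + 2 * (131072 * ((d : ℝ) + 1) ^ 2) * (KZ d L) ^ 2 * ((L : ℝ) ^ k * b)) ≤ 2)
    (hc₃ : KZ d L * ((L : ℝ) ^ k * b) ≤ c3 d L) (hs : 64 * (d : ℝ) * KZ d L * ((L : ℝ) ^ k * b) ≤ 1)
    {u : SiteZ d → 𝔸ˣ} (hax : AxialGaugeZ L U₀ (expCfg B) u k) (h81 : ∀ z : SiteZ d, uavgZ L U₀ u k z = 1) :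
    Cond166Z L U₀ u k (Real.exp (10 * d * KZ d L * ((L : ℝ) ^ k * b)) - 1) := by
  intro j hj z
  have hL1 : 1 ≤ L := by omega
  have hK : 0 ≤ KZ d L := by unfold KZ; have := gZ_nonneg d L; positivity
  rw [← iterate_flZ_pow_smul hL1 j z, eq107Z L hL1 U₀ (expCfg B) hax h81 hj]
  refine (norm_dprod_sub_one_le _ (fun i => 5 * ((d : ℝ) * KZ d L * b * (L : ℝ) ^ (j + i + 1))) (k - j) fun i hi =>
    norm_levelFactorZ_general hLs hs1 hd hG hU₀ hα hα3 hα4 h52 hb hB hsmall hc₃ hs hL1 (by omega) _).trans ?_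
  refine sub_le_sub_right (Real.exp_le_exp.mpr ?_) 1
  have hL2 : (2 : ℝ) ≤ L := by exact_mod_cast (show 2 ≤ L by omega)
  calc ∑ i ∈ range (k - j), 5 * ((d : ℝ) * KZ d L * b * (L : ℝ) ^ (j + i + 1))
      = 5 * (d : ℝ) * KZ d L * b * ∑ i ∈ range (k - j), (L : ℝ) ^ (j + i + 1) := by
        rw [mul_sum]; exact sum_congr rfl fun i _ => by ring
    _ ≤ 5 * (d : ℝ) * KZ d L * b * (2 * (L : ℝ) ^ (j + (k - j))) :=
        mul_le_mul_of_nonneg_left (sum_pow_succ_le hL2 j (k - j)) (by positivity)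
    _ = 10 * d * KZ d L * ((L : ℝ) ^ k * b) := by rw [Nat.add_sub_cancel' hj]; ring

/-- ★ **(167) AT A GENERAL REGULAR BACKGROUND, FOR THE RECORD** — every solution `u` of (67) relative to `U₀`, `U₁ = e^{B}`, `|B| ≤ b` satisfies (167) with the right-hand side `e^{θ_j} − 1`,
`θ_j = dKZ·L^{j+1}b`: by (108) for the record (`eq108Z`) the expression of (167) IS the twisted transport of `U̿^j` along `Γ_{x_{j+1},x_j}`, and (161)_rec bounds `|log U̿^j| ≤ KZ·L^jb`.
[cite: Balaban1985Averaging, (167) p.44, (108) p.33, (161) p.42; Balaban1987RG1, (0.4) p.253] -/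
theorem cond167Z_general (hLs : L = 2 * s + 1) (hs1 : 1 ≤ s) (hd : 1 ≤ d) (hG : AvgClosedZ d L G) (hU₀ : ∀ x κ, U₀ x κ ∈ G) (hα : 0 < α₀)
    (hα3 : C0Z d * α₀ ≤ 1 / 3) (hα4 : 4 * α₀ ≤ c2' d L) (h52 : pdev U₀ < α₀ * (((L : ℝ) ^ k)⁻¹) ^ 2)
    (hb : 0 ≤ b) (hB : ∀ x κ, ‖B x κ‖ ≤ b)
    (hsmall : Real.exp (4 * cZ d * α₀) * (1 + 2 * (131072 * ((d : ℝ) + 1) ^ 2) * (KZ d L) ^ 2 * ((L : ℝ) ^ k * b)) ≤ 2)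
    (hc₃ : KZ d L * ((L : ℝ) ^ k * b) ≤ c3 d L)
    {u : SiteZ d → 𝔸ˣ} (hax : AxialGaugeZ L U₀ (expCfg B) u k) :
    ∀ j < k, ∀ (z : SiteZ d) (r : Fin d → Fin L),
      ‖(((uavgZ L U₀ u j ((L : ℤ) • z))⁻¹
          * Rc (hol (avgIterZ L U₀ j) ((L : ℤ) • z) (treeWord (offZ L r)))
              (uavgZ L U₀ u j ((L : ℤ) • z + offZ L r)) : 𝔸ˣ) : 𝔸) - 1‖
        ≤ Real.exp ((d : ℝ) * KZ d L * b * (L : ℝ) ^ (j + 1)) - 1 := by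
  intro j hj z r
  obtain ⟨hV, hW, hQ⟩ := level_factsZ hLs hs1 hd hG hU₀ hα hα3 hα4 h52 hb hB hsmall hc₃ j hj.le
  have hK : 0 ≤ KZ d L := by unfold KZ; have := gZ_nonneg d L; positivity
  have ha : (0 : ℝ) ≤ KZ d L * ((L : ℝ) ^ j * b) := by positivity
  rw [eq108Z L U₀ (expCfg B) hax hj z r, hW, ← thetaZ_eq (d := d) (L := L) (b := b) j]
  exact norm_tHol_treeWordZ_sub_one_le hV _ ha hQ _ r

/-- ★★ **THE GAUGE FIXING LIES IN `Λ_k(U₀, α₃)` AT A GENERAL REGULAR BACKGROUND, FOR THE RECORD** — p. 43 made quantitative for the record: under the data of `prop4_generalZ` and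
`64·d·KZ·L^kb ≤ 1`, EVERY solution `u` of (67) + (81) relative to `U₀`, `U₁ = e^{B}`, `|B| ≤ b` satisfies (166)–(167) with `α₃ = 20dKZ·L^kb` and `η = L^{−k}`: `u ∈ Λ_k(U₀, 20dKZ·L^kb)`.
[cite: Balaban1985Averaging, p.43 (Sect. F, paragraph after (165)), (166)–(167) p.44; Balaban1987RG1, (0.4) p.253] -/
theorem inLambdaZ_general (hLs : L = 2 * s + 1) (hs1 : 1 ≤ s) (hd : 1 ≤ d) (hG : AvgClosedZ d L G) (hU₀ : ∀ x κ, U₀ x κ ∈ G) (hα : 0 < α₀)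
    (hα3 : C0Z d * α₀ ≤ 1 / 3) (hα4 : 4 * α₀ ≤ c2' d L) (h52 : pdev U₀ < α₀ * (((L : ℝ) ^ k)⁻¹) ^ 2)
    (hb : 0 ≤ b) (hB : ∀ x κ, ‖B x κ‖ ≤ b)
    (hsmall : Real.exp (4 * cZ d * α₀) * (1 + 2 * (131072 * ((d : ℝ) + 1) ^ 2) * (KZ d L) ^ 2 * ((L : ℝ) ^ k * b)) ≤ 2)
    (hc₃ : KZ d L * ((L : ℝ) ^ k * b) ≤ c3 d L) (hs : 64 * (d : ℝ) * KZ d L * ((L : ℝ) ^ k * b) ≤ 1)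
    {u : SiteZ d → 𝔸ˣ} (hax : AxialGaugeZ L U₀ (expCfg B) u k) (h81 : ∀ z : SiteZ d, uavgZ L U₀ u k z = 1) :
    InLambdaZ L U₀ u k (20 * d * KZ d L * ((L : ℝ) ^ k * b)) (((L : ℝ) ^ k)⁻¹) := by
  have hL1 : 1 ≤ L := by omega
  have hLk : (0 : ℝ) < (L : ℝ) ^ k := by positivity
  have hK : 0 ≤ KZ d L := by unfold KZ; have := gZ_nonneg d L; positivity
  have ht0 : (0 : ℝ) ≤ d * KZ d L * ((L : ℝ) ^ k * b) := by positivity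
  refine ⟨fun j hj z => (cond166Z_general hLs hs1 hd hG hU₀ hα hα3 hα4 h52 hb hB hsmall hc₃ hs hax h81 j hj z).trans ?_,
    fun j hj z r => (cond167Z_general hLs hs1 hd hG hU₀ hα hα3 hα4 h52 hb hB hsmall hc₃ hax j hj z r).trans ?_⟩
  · have := exp_sub_one_le_two_mul_of_le (x := 10 * d * KZ d L * ((L : ℝ) ^ k * b)) (by positivity) le_rfl (by linarith)
    linarith
  · obtain ⟨hθ0, hθ1⟩ := thetaZ_le (d := d) hL1 hb hs hj
    refine (exp_sub_one_le_two_mul_of_le hθ0 le_rfl (by linarith)).trans ?_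
    rw [show 20 * (d : ℝ) * KZ d L * ((L : ℝ) ^ k * b) * (L : ℝ) ^ (j + 1) * ((L : ℝ) ^ k)⁻¹
      = 20 * (d * KZ d L * b * (L : ℝ) ^ (j + 1)) * ((L : ℝ) ^ k * ((L : ℝ) ^ k)⁻¹) by ring, mul_inv_cancel₀ hLk.ne', mul_one]
    linarith

/-- **The constructed gauge fixing** `u = glevZ … k 0` of the record ((104)–(106)) at a general regular background, `U₁ = e^{B}`: `u ∈ Λ_k(U₀, 20dKZ·L^kb)` (`η = L^{−k}`).
[cite: Balaban1985Averaging, p.43 (Sect. F, paragraph after (165)), (104)–(106) p.33, (166)–(167) p.44] -/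
theorem inLambdaZ_glevZ_general (hLs : L = 2 * s + 1) (hs1 : 1 ≤ s) (hd : 1 ≤ d) (hG : AvgClosedZ d L G) (hU₀ : ∀ x κ, U₀ x κ ∈ G) (hα : 0 < α₀)
    (hα3 : C0Z d * α₀ ≤ 1 / 3) (hα4 : 4 * α₀ ≤ c2' d L) (h52 : pdev U₀ < α₀ * (((L : ℝ) ^ k)⁻¹) ^ 2)
    (hb : 0 ≤ b) (hB : ∀ x κ, ‖B x κ‖ ≤ b)
    (hsmall : Real.exp (4 * cZ d * α₀) * (1 + 2 * (131072 * ((d : ℝ) + 1) ^ 2) * (KZ d L) ^ 2 * ((L : ℝ) ^ k * b)) ≤ 2)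
    (hc₃ : KZ d L * ((L : ℝ) ^ k * b) ≤ c3 d L) (hs : 64 * (d : ℝ) * KZ d L * ((L : ℝ) ^ k * b) ≤ 1) (hL1 : 1 ≤ L) :
    InLambdaZ L U₀ (glevZ L hL1 U₀ (expCfg B) k 0) k (20 * d * KZ d L * ((L : ℝ) ^ k * b)) (((L : ℝ) ^ k)⁻¹) :=
  inLambdaZ_general hLs hs1 hd hG hU₀ hα hα3 hα4 h52 hb hB hsmall hc₃ hs (axialGaugeZ_glevZ L hL1 U₀ (expCfg B) k)
    (eq81_glevZ L hL1 U₀ (expCfg B) k)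

/-- **(166) at `j = 0` for the record: the gauge transformation itself is close to `1`** — every solution `u` of (67) + (81) relative to `U₀`, `U₁ = e^{B}`, `|B| ≤ b` satisfies `|u(x) − 1| ≤ 20dKZ·L^kb`
at EVERY site. [cite: Balaban1985Averaging, (166) p.44 (j = 0), (106) p.33] -/
theorem norm_sub_one_le_of_gaugeFixingZ (hLs : L = 2 * s + 1) (hs1 : 1 ≤ s) (hd : 1 ≤ d) (hG : AvgClosedZ d L G) (hU₀ : ∀ x κ, U₀ x κ ∈ G)
    (hα : 0 < α₀) (hα3 : C0Z d * α₀ ≤ 1 / 3) (hα4 : 4 * α₀ ≤ c2' d L) (h52 : pdev U₀ < α₀ * (((L : ℝ) ^ k)⁻¹) ^ 2)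
    (hb : 0 ≤ b) (hB : ∀ x κ, ‖B x κ‖ ≤ b)
    (hsmall : Real.exp (4 * cZ d * α₀) * (1 + 2 * (131072 * ((d : ℝ) + 1) ^ 2) * (KZ d L) ^ 2 * ((L : ℝ) ^ k * b)) ≤ 2)
    (hc₃ : KZ d L * ((L : ℝ) ^ k * b) ≤ c3 d L) (hs : 64 * (d : ℝ) * KZ d L * ((L : ℝ) ^ k * b) ≤ 1)
    {u : SiteZ d → 𝔸ˣ} (hax : AxialGaugeZ L U₀ (expCfg B) u k) (h81 : ∀ z : SiteZ d, uavgZ L U₀ u k z = 1)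
    (x : SiteZ d) : ‖((u x : 𝔸ˣ) : 𝔸) - 1‖ ≤ 20 * d * KZ d L * ((L : ℝ) ^ k * b) := by
  have h := (inLambdaZ_general hLs hs1 hd hG hU₀ hα hα3 hα4 h52 hb hB hsmall hc₃ hs hax h81).1 0 (Nat.zero_le k) x
  rwa [uavgZ_zero] at h

/-- The same for the record's constructed gauge fixing `glevZ … k 0`: `|u(x) − 1| ≤ 20dKZ·L^kb` at every site. [cite: Balaban1985Averaging, (166) p.44 (j = 0), (104)–(106) p.33] -/
theorem norm_glevZ_sub_one_le (hLs : L = 2 * s + 1) (hs1 : 1 ≤ s) (hd : 1 ≤ d) (hG : AvgClosedZ d L G) (hU₀ : ∀ x κ, U₀ x κ ∈ G) (hα : 0 < α₀)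
    (hα3 : C0Z d * α₀ ≤ 1 / 3) (hα4 : 4 * α₀ ≤ c2' d L) (h52 : pdev U₀ < α₀ * (((L : ℝ) ^ k)⁻¹) ^ 2)
    (hb : 0 ≤ b) (hB : ∀ x κ, ‖B x κ‖ ≤ b)
    (hsmall : Real.exp (4 * cZ d * α₀) * (1 + 2 * (131072 * ((d : ℝ) + 1) ^ 2) * (KZ d L) ^ 2 * ((L : ℝ) ^ k * b)) ≤ 2)
    (hc₃ : KZ d L * ((L : ℝ) ^ k * b) ≤ c3 d L) (hs : 64 * (d : ℝ) * KZ d L * ((L : ℝ) ^ k * b) ≤ 1) (hL1 : 1 ≤ L)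
    (x : SiteZ d) : ‖((glevZ L hL1 U₀ (expCfg B) k 0 x : 𝔸ˣ) : 𝔸) - 1‖ ≤ 20 * d * KZ d L * ((L : ℝ) ^ k * b) :=
  norm_sub_one_le_of_gaugeFixingZ hLs hs1 hd hG hU₀ hα hα3 hα4 h52 hb hB hsmall hc₃ hs (axialGaugeZ_glevZ L hL1 U₀ (expCfg B) k)
    (eq81_glevZ L hL1 U₀ (expCfg B) k) x

end Tower

end Literature.MathematicalPhysics.QuantumFieldTheory.Balaban1983to89.B7Eq167GeneralRec
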